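import Summits.CriticalPhenomena.PercolationContinuityZ3.Theorems.PercNearOneGluingNoHeavyLowerTailSahiThreeCopyCellBorda

/-!
# `NoHeavyLowerTail` (crux stmt-CriticalPhenomena-4575), Sahi programme: the Borda family of THREE block scores

Support file (Sahi cell, seat `prim-sahi-p1`, generation 65; `--supports stmt-CriticalPhenomena-4575`).  Definitions only (cf. `…CellBorda` for four blocks):
`perm3` (the 6 orderings) and `bordaScore3 ℓ n = 3ℓ_{σ0} + 2ℓ_{σ1} + ℓ_{σ2}`, `σ = perm3[n]`, whose argmax cells are the CHAIN cells of three block scores;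
used for the slot `F₇` at its all-`2` profile, where the triple-dominant cell has no certificate with 2-face square generators but its two chain cells do.
`domCheck` / `cellFacts_refine` of `…CellBorda` are family-generic. [this work]
-/

namespace Summit.CriticalPhenomena.PercolationContinuityZ3.Theorems.SahiThreeCopy

open Finset Function Literature.Combinatorics.Sahi2008
open scoped BigOperators

variable {k : ℕ}

/-- The 6 permutations of `{0,1,2}` in lexicographic order. [this work] -/
def perm3 : List (List ℕ) := [[0,1,2], [0,2,1], [1,0,2], [1,2,0], [2,0,1], [2,1,0]]

/-- The Borda score family of three block scores: `ℓ'_n = 3ℓ_{σ0} + 2ℓ_{σ1} + ℓ_{σ2}` for `σ = perm3[n]`. [this work] -/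
def bordaScore3 (ℓZ : ℕ → Pt k → ℤ) (n : ℕ) (e : Pt k) : ℤ :=
  3 * ℓZ ((perm3.getD n []).getD 0 0) e + 2 * ℓZ ((perm3.getD n []).getD 1 0) e + ℓZ ((perm3.getD n []).getD 2 0) e

end Summit.CriticalPhenomena.PercolationContinuityZ3.Theorems.SahiThreeCopy
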